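import Summits.ResolutionOfSingularities.ResolutionOfSingularities.Theorems.HilbertSamuelEliminationSigmaMaxModificationsCorridor3WLadderMovingAlt
import Summits.ResolutionOfSingularities.ResolutionOfSingularities.Theorems.HilbertSamuelEliminationSigmaMaxModificationsCorridor3WLadderIsoTransitionLaw
import Summits.ResolutionOfSingularities.ResolutionOfSingularities.Theorems.HilbertSamuelEliminationSigmaMaxModificationsCorridor3WLadderForcedGameTowersJoin
import Summits.ResolutionOfSingularities.ResolutionOfSingularities.Theorems.HilbertSamuelEliminationSigmaMaxModificationsCorridor3WLadderIsoProximity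
import HarnessLib

/-!
# [OURS · L1 W4.2] MODULE `Corridor3WLadderMovingAltRecIso` (crux chain w42) — D16 part 3: the v8.1 POINTED STUB
# `stub_WtopRecIsoM_pointed : ∀ p, p.Prime → WtopRecIsoM p QPointed` from the isolated KERNEL and the ALT row

DEAL D16 part 3 (res-L1-w42-plan-1 RULINGS v3.14-8 (BZ) 2026-08-27T09:50:06Z: «CLOSER SHAPE OF RECORD :=
`wtopRecIsoM_pointed_of_kernel (hT : IsoQuadraticTowerTerminates p 3) (halt : WtopAltM p QPointed) : WtopRecIsoM p QPointed` (your trichotomy minus the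
`hev` leg)»).  The legs are EXACT: in the r4/D16 vocabulary «isolated infinitely often» (Rec-Iso) = «eventually isolated» (Ev-Iso) ⊔ «isolated AND
non-isolated infinitely often» (ALT) on the nose — `noMovingRecurrentNearChainFrom_iff_eventually_alternating` (one `eventually_not_or_io`).  Row level,
for EVERY origin predicate `Q`: `wtopRecIsoM_of_evIso_alt : WtopEvIsoM p Q → WtopAltM p Q → WtopRecIsoM p Q` (+ converse pieces); at `QPointed`
with the Ev-Iso leg discharged from the kernel through D7 (`wtopEvIsoM_of_towers`, `isoTailTowerExtractionM_holds` res-D-pv-042):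
`wtopRecIsoM_pointed_of_kernel`; with ALT discharged through D17 (res-type-067 `wtopAltM_of_noRecurrentIsoPointBirth3`, res-L1-type-o1
`isoTransitionLaw3_holds` p520356 — unconditional): `wtopRecIsoM_pointed_of_kernel_of_birthLaw (hT) (hrec : NoRecurrentIsoPointBirth3 p QPointed)`;
and the FLOOR forms with the kernel entering through the C4 floor (P1 ∧ T3, `IdeasL1C4.isoQuadraticTowerTerminates_of_algIsolated` p516568) or the
C5 cover (`IdeasL1C5.isoQuadraticTowerTerminates_of_four` p518905).  So the v8.1 pointed stub reads, by name:

  `WtopRecIsoM p QPointed ⟸ IsoQuadraticTowerTerminates p 3 (⟸ P1 ∧ T3, or K1 ∧ (k2) ∧ K2-sep ∧ K3-sep) ∧ NoRecurrentIsoPointBirth3 p QPointed`.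

Everything PROVED here is a join; the open content is the kernel (D14/D15, ideation K2/K3) and the eventual birth law (OURS claim, ideation r8).
`--supports stmt-…-19249 --as helper`, counted 0.  OURS; NOT statements of [CossartJannsenSaito2020] nor of the manuscript [Hironaka2017]; AI typing,
weaker than expert review.
-/

set_option linter.dupNamespace false

open CategoryTheory AlgebraicGeometry TopologicalSpace
open Summit.ResolutionOfSingularities.ResolutionOfSingularities.Theorems.CampaignW42
open Literature.AlgebraicGeometry.Resolution Literature.RingTheory.HilbertSamuel
open Literature.AlgebraicGeometry.CossartJannsenSaito2020
open Summit.ResolutionOfSingularities.ResolutionOfSingularities.Theses.HilbertSamuelElimination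
open Summit.ResolutionOfSingularities.ResolutionOfSingularities.Theorems.SigmaMaxModificationsCorridor3
open Summit.ResolutionOfSingularities.ResolutionOfSingularities.Theorems.SigmaMaxModificationsCorridor3.Moving
open Summit.ResolutionOfSingularities.ResolutionOfSingularities.Theorems.SigmaMaxModificationsCorridor3.Helpers (QPointed)
open Summit.ResolutionOfSingularities.ResolutionOfSingularities.Cruxes.SigmaMaxModifications

namespace Summit.ResolutionOfSingularities.ResolutionOfSingularities.Cruxes.SigmaMaxModifications.IdeasL1Idea2R4

universe u

variable {R : ∀ S : Scheme.{u}, CentreSeq S → Prop} {N : ℕ} {ν : ℕ → ℕ}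

/-! ## §1. Rec = Ev ⊔ Alt, on the nose -/

/-- **«`B` infinitely often» = «eventually `B`» ⊔ «`B` and `¬ B` both infinitely often»** for moving chains (proved; one
`eventually_not_or_io` on `¬ B`, tails via `reaches_chain` / `io_shift`). [folklore] -/
theorem noMovingRecurrentNearChainFrom_iff_eventually_alternating {s₀ : MarkedStage.{u}} {G : MarkedStage.{u} → Prop}
    (B : MarkedStage.{u} → Prop) :
    NoMovingRecurrentNearChainFrom R N ν s₀ G B ↔
      (NoMovingNearChainFrom R N ν s₀ fun s => G s ∧ B s) ∧ NoMovingAlternatingNearChainFrom R N ν s₀ G B := by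
  constructor
  · intro h
    refine ⟨?_, noMovingAlternatingNearChainFrom_of_recurrent h⟩
    rintro ⟨c, h0, hstep, hG, hmov⟩
    exact h ⟨c, h0, hstep, fun n => (hG n).1, hmov, fun n => ⟨n, le_rfl, (hG n).2⟩⟩
  · rintro ⟨hev, halt⟩ ⟨c, h0, hstep, hG, hmov, hio⟩
    rcases eventually_not_or_io (fun n => ¬ B (c n)) with ⟨n₀, hn₀⟩ | hioN
    · -- eventually inside `B`: the tail from `n₀` is a `G ∧ B` chain
      exact hev ⟨fun n => c (n₀ + n), reaches_chain h0 hstep n₀, fun n => hstep (n₀ + n),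
        fun n => ⟨hG _, Classical.not_not.1 (hn₀ _ (Nat.le_add_right _ _))⟩, io_shift hmov n₀⟩
    · exact halt ⟨c, h0, hstep, hG, hmov, hio, hioN⟩

/-- **Row level, every origin predicate `Q`: Ev-Iso ∧ ALT ⇒ Rec-Iso** (proved). [folklore] -/
theorem wtopRecIsoM_of_evIso_alt {p : ℕ} {Q : ℕ → (ℕ → ℕ) → ∀ X : Scheme.{u}, X → Prop}
    (hev : WtopEvIsoM.{u} p Q) (halt : WtopAltM.{u} p Q) : WtopRecIsoM.{u} p Q :=
  fun R hRf hRa ν X _ x hX hQ =>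
    (noMovingRecurrentNearChainFrom_iff_eventually_alternating (fun s => Iso 3 s)).2
      ⟨hev R hRf hRa ν X x hX hQ, halt R hRf hRa ν X x hX hQ⟩

/-- … and conversely Rec-Iso gives back both legs (exactness; the ALT half is `wtopAltM_of_wtopRecIsoM`, p519348). [folklore] -/
theorem evIso_alt_of_wtopRecIsoM {p : ℕ} {Q : ℕ → (ℕ → ℕ) → ∀ X : Scheme.{u}, X → Prop} (h : WtopRecIsoM.{u} p Q) :
    WtopEvIsoM.{u} p Q ∧ WtopAltM.{u} p Q :=
  ⟨fun R hRf hRa ν X _ x hX hQ =>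
      ((noMovingRecurrentNearChainFrom_iff_eventually_alternating (fun s => Iso 3 s)).1 (h R hRf hRa ν X x hX hQ)).1,
    wtopAltM_of_wtopRecIsoM h⟩

/-! ## §2. The v8.1 pointed stub `WtopRecIsoM p QPointed` — CLOSER SHAPE OF RECORD and its by-name floors -/

/-- **CLOSER SHAPE OF RECORD (RULINGS v3.14-8 (BZ)): the pointed isolated-recurrent row from the KERNEL and ALT** — the Ev-Iso leg discharged
through r4's `wtopEvIsoM_of_towers` with D7's `isoTailTowerExtractionM_holds` (res-D-pv-042). OURS join; not a citation of print. -/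
theorem wtopRecIsoM_pointed_of_kernel {p : ℕ} (hT : IsoQuadraticTowerTerminates.{u} p 3) (halt : WtopAltM.{u} p QPointed) :
    WtopRecIsoM.{u} p QPointed :=
  wtopRecIsoM_of_evIso_alt (wtopEvIsoM_of_towers hT (isoTailTowerExtractionM_holds p) QPointed) halt

/-- **… with ALT discharged by D17**: the transition law is a theorem (res-L1-type-o1 `isoTransitionLaw3_holds`, p520356) and res-type-067's
`wtopAltM_of_noRecurrentIsoPointBirth3` turns the eventual birth law into ALT — so the pointed stub rests on the KERNEL and ONE conjecture-tagged
OURS claim `NoRecurrentIsoPointBirth3 p QPointed`. OURS join. -/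
theorem wtopRecIsoM_pointed_of_kernel_of_birthLaw {p : ℕ} (hT : IsoQuadraticTowerTerminates.{u} p 3)
    (hrec : Moving.NoRecurrentIsoPointBirth3.{u} p QPointed) : WtopRecIsoM.{u} p QPointed :=
  wtopRecIsoM_pointed_of_kernel hT (Moving.wtopAltM_of_noRecurrentIsoPointBirth3 (Moving.isoTransitionLaw3_holds p QPointed) hrec)

/-- **THE FLOOR OF THE v8.1 POINTED STUB, frame route (card C4):** `WtopRecIsoM p QPointed` from P1 (`AlgIsolatedOfIsolated`, DEAL D15), the
residual core T3 (`IsoTranslationTowersImpossible p`) and the eventual birth law — the kernel entering through the C4 floor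
`IdeasL1C4.isoQuadraticTowerTerminates_of_algIsolated` (K-FORCED ∘ D5 ∘ D2, p516568). OURS join. -/
theorem wtopRecIsoM_pointed_of_floor {p : ℕ} (hP1 : IdeasL1C4.AlgIsolatedOfIsolated.{u})
    (h3 : IdeasL1C4.IsoTranslationTowersImpossible.{u} p) (hrec : Moving.NoRecurrentIsoPointBirth3.{u} p QPointed) :
    WtopRecIsoM.{u} p QPointed :=
  wtopRecIsoM_pointed_of_kernel_of_birthLaw (IdeasL1C4.isoQuadraticTowerTerminates_of_algIsolated p hP1 h3) hrec

/-- **The same floor through the proximity trichotomy (card C5):** K1 (free-rational tails, DEAL D14), (k2) `IsoInsepTowerTerminates`, the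
separable-restricted K2/K3, and the eventual birth law (`IdeasL1C5.isoQuadraticTowerTerminates_of_four`, p518905). OURS join. -/
theorem wtopRecIsoM_pointed_of_floor_proximity {p : ℕ} (h1 : IdeasL1C5.IsoFreeRationalTailsImpossible.{u} p 3)
    (hI : IdeasL1C5.IsoInsepTowerTerminates.{u} p 3) (h2 : IdeasL1C5.IsoSepJumpRecurrentImpossible.{u} p 3)
    (h3 : IdeasL1C5.IsoSepSatelliteRecurrentImpossible.{u} p 3) (hrec : Moving.NoRecurrentIsoPointBirth3.{u} p QPointed) :
    WtopRecIsoM.{u} p QPointed :=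
  wtopRecIsoM_pointed_of_kernel_of_birthLaw (IdeasL1C5.isoQuadraticTowerTerminates_of_four h1 hI h2 h3) hrec

end Summit.ResolutionOfSingularities.ResolutionOfSingularities.Cruxes.SigmaMaxModifications.IdeasL1Idea2R4
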